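import Summits.CriticalPhenomena.CardyFormulaZ2.Theorems.CardyMagicRigidityNestingRigidityNeckZ2TouchDensity
import Literature.Probability.Percolation.BKFinitary
import HarnessLib

/-!
# Crux `NestingRigidity`, line `pinch-resampling` (v4), stub S12: arms of pairwise DISTINCT open clusters cost the product (van den Berg–Kesten)

Crux `Summit.CriticalPhenomena.CardyFormulaZ2.Theses.CardyMagicRigidity.NestingRigidity`
(stmt-CriticalPhenomena-4835), line `pinch-resampling` v4, stub S12 `stub_neckHookupCoarseZ2 : NeckHookupCoarseZ2`.
The third probabilistic primitive of the summation of the `𝔄`-error (with `…NeckZ2NodeProduct` and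
`…NeckZ2TouchDensity`), consuming the necklace structure of `…NeckZ2CoveringAChain` (the open clusters met along
the minimal re-connecting family are pairwise distinct, and at least every other one contains a blob of sup-diameter
`≥ lam`): **if pairwise distinct open clusters join `c i` (within sup distance `< r i` of `w i`) to sup distance
`≥ R i` from `w i`, the probability is at most `∏ C (r i / (R i - 1))^α`** — with NO disjointness hypothesis on the
annuli (they may overlap arbitrarily): distinct clusters give vertex-disjoint, hence edge-disjoint, open witnesses,
and the tree's finitary BK inequality `bk_finitary_list` (`BKFinitary.lean`) applies to the one-arm events
`NeckCoarseZ2.zOneArmAt` (`…NeckZ2TouchDensity`, bound `real_zOneArmAt_le`).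

* §1 Finite open witnesses of `PathIn` (`exists_finset_witness_of_pathIn`); `zOneArmAt` is increasing and finitary.
* §2 `real_distinctClusters_arms_le_prod` (registered anchor).
-/

noncomputable section

namespace Summit.CriticalPhenomena.CardyFormulaZ2.Cruxes.NestingRigidity.PinchResampling

open MeasureTheory Set Literature.Probability.Percolation Literature.Probability.LatticeModels
open ZPinchLocality

namespace NeckCoarseZ2

variable {ω : BondConfig (Site 2)}

/-! ## §1 Finite open witnesses -/

/-- **Finite open witness of a path**: an open path inside `A` from `u` to `v` is carried by a finite set `K ⊆ ω` of
open edges, every vertex of which is joined to `u` inside `A`. -/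
theorem exists_finset_witness_of_pathIn {A : Set (Site 2)} {u v : Site 2} (h : PathIn (openGraph ω) A u v) :
    ∃ K : Finset (Sym2 (Site 2)), ↑K ⊆ ω ∧ PathIn (openGraph ↑K) A u v ∧
      ∀ e ∈ K, ∀ z ∈ e, PathIn (openGraph ω) A u z := by
  classical
  obtain ⟨hu, p⟩ := h
  induction p with
  | refl => exact ⟨∅, by simp, PathIn.refl hu, by simp⟩
  | @tail b c hub hbc ih =>
    obtain ⟨K, hKω, hK, hKu⟩ := ih
    have hbc' := (openGraph_adj ω b c).1 hbc.1
    have hub' : PathIn (openGraph ω) A u b := ⟨hu, hub⟩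
    refine ⟨insert s(b, c) K, ?_, ?_, ?_⟩
    · rw [Finset.coe_insert]
      exact insert_subset hbc'.1 hKω
    · refine (hK.mono_graph (openGraph_mono (by simp))).tail ?_ hbc.2
      rw [openGraph_adj]
      exact ⟨by simp, hbc'.2⟩
    · intro e he z hz
      rcases Finset.mem_insert.1 he with rfl | he
      · rcases Sym2.mem_iff.1 hz with rfl | rfl
        · exact hub'
        · exact hub'.tail hbc.1 hbc.2
      · exact hKu e he z hz

/-- The one-arm event is increasing. -/
theorem isUpperSet_zOneArmAt (w : Site 2) (r R : ℕ) : IsUpperSet (zOneArmAt w r R) := by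
  rintro ω ω' hle ⟨p, q, hp, hq, hpath⟩
  exact ⟨p, q, hp, hq, hpath.mono_graph (openGraph_mono hle)⟩

/-- The one-arm event is finitary (witnessed by finite open paths). -/
theorem isFinitary_zOneArmAt (w : Site 2) (r R : ℕ) : IsFinitary (zOneArmAt w r R) := by
  rintro ω ⟨p, q, hp, hq, hpath⟩
  obtain ⟨K, hKω, hK, -⟩ := exists_finset_witness_of_pathIn hpath
  exact ⟨K, hKω, p, q, hp, hq, hK⟩

/-- **Witnesses in distinct clusters**: on a lattice configuration, if pairwise distinct open clusters join each
`c i` (`|c i - w i|_∞ < r i`) to sup distance `≥ R i` from `w i` (`r i ≤ R i`), then the one-arm events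
`zOneArmAt (w i) (r i) (R i)` occur disjointly. -/
theorem mem_disjointOccurrenceList_of_distinctClusters (hHG : ∀ a b, (openGraph ω).Adj a b → (zdGraph 2).Adj a b)
    {ι : Type*} (l : List ι) (hl : l.Nodup) (w c : ι → Site 2) (r R : ι → ℕ) (hrR : ∀ i ∈ l, r i ≤ R i)
    (hnear : ∀ i ∈ l, zNorm (c i - w i) < r i)
    (hfar : ∀ i ∈ l, ∃ q, (R i : ℤ) ≤ zNorm (q - w i) ∧ PathIn (openGraph ω) univ (c i) q)
    (hdist : ∀ i ∈ l, ∀ j ∈ l, i ≠ j → ¬ PathIn (openGraph ω) univ (c i) (c j)) :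
    ω ∈ disjointOccurrenceList (l.map fun i ↦ zOneArmAt (w i) (r i) (R i)) := by
  classical
  -- crossing extraction and finite witnesses, cluster by cluster
  have key : ∀ i ∈ l, ∃ K : Finset (Sym2 (Site 2)), ↑K ⊆ ω ∧ (↑K : Set (Sym2 (Site 2))) ∈ zOneArmAt (w i) (r i) (R i) ∧
      ∀ e ∈ K, ∀ z ∈ e, PathIn (openGraph ω) univ (c i) z := by
    intro i hi
    obtain ⟨q, hqR, hpath⟩ := hfar i hi
    obtain ⟨p₁, q₁, hp₁, hq₁, hcross, hcp⟩ :=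
      exists_zAnn_crossing_of_pathIn hHG (hrR i hi) (hnear i hi) hqR hpath
    obtain ⟨K, hKω, hK, hKu⟩ := exists_finset_witness_of_pathIn hcross
    refine ⟨K, hKω, ⟨p₁, q₁, hp₁, hq₁, hK.mono inter_subset_right⟩, fun e he z hz ↦ ?_⟩
    exact hcp.trans ((hKu e he z hz).mono inter_subset_left)
  choose! K hKω hKA hKc using key
  have hmem := mem_disjointOccurrenceList_of_pairwise_disjoint
    (l.map fun i ↦ (zOneArmAt (w i) (r i) (R i), (↑(K i) : Set (Sym2 (Site 2)))))
    (fun p hp ↦ by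
      obtain ⟨i, -, rfl⟩ := List.mem_map.1 hp
      exact isUpperSet_zOneArmAt _ _ _)
    (fun p hp ↦ by
      obtain ⟨i, hi, rfl⟩ := List.mem_map.1 hp
      exact hKA i hi)
    ?_ (ω := ω) (fun p hp ↦ by
      obtain ⟨i, hi, rfl⟩ := List.mem_map.1 hp
      exact hKω i hi)
  · simpa only [List.map_map, Function.comp_def] using hmem
  · rw [List.pairwise_map]
    refine hl.pairwise_of_forall_ne fun i hi j hj hij ↦ ?_
    rw [Finset.disjoint_coe, Finset.disjoint_left]
    intro e hei hej
    obtain ⟨z, hz⟩ : ∃ z, z ∈ e := ⟨e.out.1, Sym2.out_fst_mem e⟩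
    exact hdist i hi j hj hij ((hKc i hi e hei z hz).trans (hKc j hj e hej z hz).symm)

end NeckCoarseZ2

/-! ## §2 The BK bound for arms of distinct clusters -/

/-- **Arms of pairwise distinct open clusters cost the product of the one-arm bounds (registered helper, anchor of this
module on the crux item).**  There are `C, α > 0` (the constants of `NeckCoarseZ2.real_zOneArmAt_le`) such that for
every finite index set `t`, centres `w i`, radii `1 ≤ r i < R i` — the annuli may OVERLAP arbitrarily — the
probability under `P_{1/2}` on `ℤ²` that there are points `c i` with `|c i - w i|_∞ < r i`, each joined by an open
path to sup distance `≥ R i` from `w i`, the `c i` lying in pairwise DISTINCT open clusters, is at most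
`∏ C (r i / (R i - 1))^α` (crossing extraction, edge-disjoint finite witnesses, `bk_finitary_list`,
`real_zOneArmAt_le`). -/
theorem real_distinctClusters_arms_le_prod : ∃ C α : ℝ, 0 < C ∧ 0 < α ∧ ∀ (ι : Type) (t : Finset ι) (w : ι → Site 2) (r R : ι → ℕ), (∀ i ∈ t, 1 ≤ r i ∧ r i + 1 ≤ R i) → (bondPercolation (zdGraph 2) half).real {ω | ∃ c : ι → Site 2, (∀ i ∈ t, zNorm (c i - w i) < r i ∧ ∃ q, (R i : ℤ) ≤ zNorm (q - w i) ∧ PathIn (openGraph ω) Set.univ (c i) q) ∧ ∀ i ∈ t, ∀ j ∈ t, i ≠ j → ¬ PathIn (openGraph ω) Set.univ (c i) (c j)} ≤ ∏ i ∈ t, C * ((r i : ℝ) / ((R i - 1 : ℕ) : ℝ)) ^ α := by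
  obtain ⟨C, α, hC, hα, h1⟩ := NeckCoarseZ2.real_zOneArmAt_le
  refine ⟨C, α, hC, hα, fun ι t w r R hrR ↦ ?_⟩
  classical
  set μ := bondPercolation (zdGraph 2) half with hμ
  set E := {ω : BondConfig (Site 2) | ∃ c : ι → Site 2, (∀ i ∈ t, zNorm (c i - w i) < r i ∧
    ∃ q, (R i : ℤ) ≤ zNorm (q - w i) ∧ PathIn (openGraph ω) Set.univ (c i) q) ∧
    ∀ i ∈ t, ∀ j ∈ t, i ≠ j → ¬ PathIn (openGraph ω) Set.univ (c i) (c j)} with hE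
  set L := t.toList.map fun i ↦ NeckCoarseZ2.zOneArmAt (w i) (r i) (R i) with hL
  -- off a null set, the event implies disjoint occurrence of the one-arm events
  have hcover : E ∩ {ω | ω ⊆ (zdGraph 2).edgeSet} ⊆ disjointOccurrenceList L := by
    rintro ω ⟨⟨c, hc, hdist⟩, hlat⟩
    have hHG : ∀ a b, (openGraph ω).Adj a b → (zdGraph 2).Adj a b := fun a b h ↦
      (SimpleGraph.mem_edgeSet _).1 (hlat ((openGraph_adj ω a b).1 h).1)
    exact NeckCoarseZ2.mem_disjointOccurrenceList_of_distinctClusters hHG t.toList (Finset.nodup_toList t) w c r R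
      (fun i hi ↦ by have := (hrR i (Finset.mem_toList.1 hi)).2; omega)
      (fun i hi ↦ (hc i (Finset.mem_toList.1 hi)).1) (fun i hi ↦ (hc i (Finset.mem_toList.1 hi)).2)
      fun i hi j hj hij ↦ hdist i (Finset.mem_toList.1 hi) j (Finset.mem_toList.1 hj) hij
  have hae : ∀ᵐ ω ∂μ, ω ⊆ (zdGraph 2).edgeSet := ae_subset_edgeSet (zdGraph 2) half
  have heq : μ.real E = μ.real (E ∩ {ω | ω ⊆ (zdGraph 2).edgeSet}) := by
    refine measureReal_congr (Filter.eventuallyEq_set.2 (hae.mono fun ω hω ↦ ?_))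
    simp only [mem_inter_iff, mem_setOf_eq, hω, and_true]
  have hup : ∀ A ∈ L, IsUpperSet A := fun A hA ↦ by
    obtain ⟨i, -, rfl⟩ := List.mem_map.1 hA
    exact NeckCoarseZ2.isUpperSet_zOneArmAt _ _ _
  have hfin : ∀ A ∈ L, IsFinitary A := fun A hA ↦ by
    obtain ⟨i, -, rfl⟩ := List.mem_map.1 hA
    exact NeckCoarseZ2.isFinitary_zOneArmAt _ _ _
  calc μ.real E = μ.real (E ∩ {ω | ω ⊆ (zdGraph 2).edgeSet}) := heq
    _ ≤ μ.real (disjointOccurrenceList L) := measureReal_mono hcover (measure_ne_top _ _)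
    _ ≤ (L.map μ.real).prod := bk_finitary_list (zdGraph 2) half L hup hfin
    _ = ∏ i ∈ t, μ.real (NeckCoarseZ2.zOneArmAt (w i) (r i) (R i)) := by
        rw [hL, List.map_map, Function.comp_def, Finset.prod_map_toList]
    _ ≤ ∏ i ∈ t, C * ((r i : ℝ) / ((R i - 1 : ℕ) : ℝ)) ^ α :=
        Finset.prod_le_prod (fun i _ ↦ measureReal_nonneg) fun i hi ↦ h1 (w i) (r i) (R i) (hrR i hi).1 (hrR i hi).2

end Summit.CriticalPhenomena.CardyFormulaZ2.Cruxes.NestingRigidity.PinchResampling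

end
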